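import Summits.NavierStokesRegularity.NavierStokesRegularity.Theorems.StrainDoorsDSSThreeNumbers
import Literature.Analysis.FluidPDE.ChaeWolfRemovingDSSBounds
import Literature.Analysis.Calculus.DerivativeInterpolation
import HarnessLib

/-!
# StrainDoorsDSSThreeNumbersHolds — the three numbers theorem, HYPOTHESIS-FREE on Chae–Wolf's class

nsreg-p1 g35, ROUND-55 PART D (helper lane of `stmt-NavierStokesRegularity-0056`, rung N0; lands after PART C
`StrainDoorsDSSThreeNumbers`).

PART C proved the three numbers theorem for `c`-DSS classical solutions in Chae–Wolf's class modulo ONE input, a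
gradient bound (the shell bound / Chae–Wolf's (3.6)).  Here that input is DISCHARGED IN THE TREE:

* §1 `window_transfer_hess` + `exists_uniform_hessBound` — **the a priori estimate (3.6) with `l = 2`, bounded
  form**: for every `C₀ ≥ 0` there is `K₂` such that every classical solution on `t < 0` (`ν = 1`) with the Type-I
  bound `HasTypeIDecay C₀ u` has `‖D²u(t,·)‖ ≤ K₂` on `t ≤ −1/4` — KNSS 2009 §4 for bounded weak solutions on the
  windows `(t − 2, t + 1/8)` (`KNSS2009_regularity_boundedWeak_window_holds`, PROVED in the tree), transferred from
  the KNSS representative `U + b(t)` to `u` at almost every time and then to every time by continuity (the tree's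
  `ChaeWolf.exists_uniform_lipschitz` is the `l = 1` case; this is its verbatim `l = 2` twin).
* §2 `chaeWolf_periodGradDecay` — **gradient decay on a period slab**: Landau's interpolation inequality
  (`Literature.Analysis.Calculus.norm_iteratedFDeriv_succ_le_of_bounds`: `‖Du‖ ≤ 2 sup|u|/s + s sup‖D²u‖` on balls)
  between the Type-I velocity DECAY and the uniform Hessian BOUND gives `∇u(t,x) → 0` as `|x| → ∞` uniformly on
  `t ∈ [−c², −1]` — the period gradient decay hypothesis of ROUND-53's attainment theorems.
* §3 ★★★ `chaeWolf_dss_three_numbers_holds` — **THE THREE NUMBERS OF A DSS SINGULARITY, UNCONDITIONALLY ON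
  CHAE–WOLF'S CLASS**: every `c`-discretely self-similar (`c > 1`) classical solution of Navier–Stokes (`ν = 1`)
  on `t < 0` with slices continuous into `L^q(ℝ³)`, `q ≥ 3`, and `ω ≢ 0` ATTAINS its strain number
  `N* = max (0 − t)λ₁ ≥ 1`, its vorticity number `W* = max (0 − t)|ω|` and its velocity number
  `V*² = max (0 − t)|u|²`, and at the three record points the strain record law
  `N* + N*² − (0 − t)²Δ-credit ≤ (0 − t)²H`, the vorticity record law `1 + (0 − t_ω)|∇ξ|²_F ≤ (0 − t_ω)q(ξ) ≤ N*`
  and the velocity record law `|u|(1 + 2(0 − t_v)|∇û|²_F) ≤ 2(0 − t_v)(−û·∇p)`, `|u| ≤ 2(0 − t_v)|∇p|` hold —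
  with NO hypothesis beyond the class (Chae–Wolf's Theorem 1.1 and KNSS §4 are used BY NAME through their tree
  proofs `chaeWolf2017_dss_typeI_decay_holds`, `KNSS2009_regularity_boundedWeak_window_holds`).
  `dss_strain_record_law_holds` / `dss_vorticity_record_law_holds` are the N- and W-laws alone.

WHAT THIS IS NOT: `TypeIDSSLiouville` (Bradshaw–Tsai OP 5.1) stays OPEN — these are necessary conditions met by
every DSS blow-up candidate of the class; no profile is excluded; `0056`/NS regularity are not proved.  No new
definitions; no sorry.
[cite: ChaeWolf2017RemovingDSS, Theorem 1.1 and §3 (3.6) (arXiv:1610.09464 p. 3, 8); KochNadirashviliSereginSverak2009, §4 (arXiv:0709.3599 p. 8)]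
-/

noncomputable section

open MeasureTheory Set Function Filter Metric Real InnerProductSpace
open _root_.Topology
open scoped ENNReal NNReal RealInnerProductSpace ContDiff Laplacian
open Literature.Analysis Literature.Analysis.FluidPDE
open Literature.Analysis.FluidPDE.VorticityDirectionDynamics

set_option linter.dupNamespace false

namespace Summit.NavierStokesRegularity.NavierStokesRegularity.Theorems.StrainDoors

open Summit.NavierStokesRegularity.NavierStokesRegularity.Theorems.ArgmaxDoors

set_option maxSynthPendingDepth 3

/-! ## §1 Uniform Hessian bounds for Type-I classical solutions (Chae–Wolf (3.6), `l = 2`) -/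

/-- **Transfer of the KNSS window bound of order two.**  If `w` is jointly smooth on `(0,T) × ℝ³` and
`w(τ,·) = U(τ,·) + b(τ)` a.e. in `x` for a.e. `τ ∈ (0,T)`, with smooth slices `U(τ,·)` obeying `‖D²U‖ ≤ C₂` on
`(1,T)` (the output of `KNSS2009_regularity_boundedWeak_window`), then `‖D²w(τ,·)‖ ≤ C₂` at EVERY `τ ∈ (1,T)`
(both sides of the a.e. identity are continuous in `x`, so it holds everywhere at good times; the constant drift
`b(τ)` has no second derivative; continuity in `τ` removes the exceptional times). [folklore] -/
theorem window_transfer_hess {T C₂ : ℝ}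
    {w U : ℝ → (EuclideanSpace ℝ (Fin 3)) → (EuclideanSpace ℝ (Fin 3))} {b : ℝ → EuclideanSpace ℝ (Fin 3)}
    (hw : IsSmoothSpaceTimeOn (Ioo 0 T) w)
    (hae : ∀ᵐ τ ∂((volume : Measure ℝ).restrict (Ioo 0 T)), w τ =ᵐ[volume] fun x => U τ x + b τ)
    (hUs : ∀ τ ∈ Ioo 0 T, ContDiff ℝ ∞ (U τ))
    (hUC : ∀ τ ∈ Ioo 1 T, ∀ x, ‖iteratedFDeriv ℝ 2 (U τ) x‖ ≤ C₂) :
    ∀ τ ∈ Ioo 1 T, ∀ x : EuclideanSpace ℝ (Fin 3), ‖iteratedFDeriv ℝ 2 (w τ) x‖ ≤ C₂ := by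
  have hSU : UniqueDiffOn ℝ (Ioo 0 T) := isOpen_Ioo.uniqueDiffOn
  have hsub1 : Ioo 1 T ⊆ Ioo 0 T := Ioo_subset_Ioo_left zero_le_one
  have hwx : ∀ τ ∈ Ioo 0 T, Continuous (w τ) := fun τ hτ => (hw.contDiff_slice hτ).continuous
  -- good times: the a.e. identity holds everywhere in `x`
  have hgood : ∀ᵐ τ ∂((volume : Measure ℝ).restrict (Ioo 0 T)),
      τ ∈ Ioo 0 T ∧ ∀ x, w τ x = U τ x + b τ := by
    filter_upwards [hae, ae_restrict_mem measurableSet_Ioo] with τ hτ hτm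
    refine ⟨hτm, fun x => ?_⟩
    have hc2 : Continuous fun x => U τ x + b τ := (hUs τ hτm).continuous.add continuous_const
    exact congr_fun ((Continuous.ae_eq_iff_eq volume (hwx τ hτm) hc2).1 hτ) x
  have hgood1 : ∀ᵐ τ ∂((volume : Measure ℝ).restrict (Ioo 1 T)),
      τ ∈ Ioo 0 T ∧ ∀ x, w τ x = U τ x + b τ :=
    ae_restrict_of_ae_restrict_of_subset hsub1 hgood
  intro τ₀ hτ₀ x
  -- continuity in `τ` of `‖D²w(τ,x)‖ = ‖D(Dw(τ,·))(x)‖`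
  have hcont : ContinuousOn (fun τ => ‖iteratedFDeriv ℝ 2 (w τ) x‖) (Ioo 1 T) := by
    have h1 := ((hw.fderiv_slice hSU).continuousOn_fderiv_slice hSU).comp
      (continuousOn_id.prodMk continuousOn_const) (fun τ hτ => mk_mem_prod hτ (mem_univ x))
    have h2 : ContinuousOn (fun τ => ‖fderiv ℝ (fun y => fderiv ℝ (w τ) y) x‖) (Ioo 1 T) :=
      (h1.mono hsub1).norm
    refine h2.congr fun τ _ => ?_
    show ‖iteratedFDeriv ℝ 2 (w τ) x‖ = ‖fderiv ℝ (fun y => fderiv ℝ (w τ) y) x‖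
    rw [← norm_iteratedFDeriv_fderiv, ChaeWolf.norm_iteratedFDeriv_one_eq_norm_fderiv]
  refine ChaeWolf.le_of_ae_le_of_continuousOn hcont ?_ τ₀ hτ₀
  filter_upwards [hgood1, ae_restrict_mem measurableSet_Ioo] with τ hτ hτ1
  have heq : w τ = (U τ + fun _ => b τ) := funext hτ.2
  have hU2 : ContDiffAt ℝ (2 : ℕ) (U τ) x :=
    ((hUs τ hτ.1).of_le (m := (2 : ℕ)) (by norm_cast)).contDiffAt
  have hb2 : ContDiffAt ℝ (2 : ℕ) (fun _ : EuclideanSpace ℝ (Fin 3) => b τ) x := contDiffAt_const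
  rw [heq, iteratedFDeriv_add_apply hU2 hb2, iteratedFDeriv_const_of_ne (by norm_num) (b τ),
    Pi.zero_apply, add_zero]
  exact hUC τ hτ1 x

/-- **Chae–Wolf (3.6) with `l = 2`, bounded form: a uniform Hessian bound for Type-I classical solutions.**
For every `C₀ ≥ 0` there is `K₂ ≥ 0` such that every classical solution `(u,p)` of Navier–Stokes (`ν = 1`,
`f = 0`) on `ℝ³ × (−∞,0)` with `HasTypeIDecay C₀ u` satisfies `‖D²u(t,x)‖ ≤ K₂` for all `t ≤ −1/4` and all `x`
(KNSS 2009 §4 on the window `(t − 2, t + 1/8)`, where `|u| ≤ 3C₀`; verbatim the `l = 2` twin of the tree's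
`ChaeWolf.exists_uniform_lipschitz`). [cite: ChaeWolf2017RemovingDSS, §3 (3.6) (arXiv:1610.09464 p. 8); KochNadirashviliSereginSverak2009, §4] -/
theorem exists_uniform_hessBound {C₀ : ℝ} (hC₀ : 0 ≤ C₀) :
    ∃ K₂ : ℝ, 0 ≤ K₂ ∧ ∀ {u : ℝ → EuclideanSpace ℝ (Fin 3) → EuclideanSpace ℝ (Fin 3)}
      {p : ℝ → EuclideanSpace ℝ (Fin 3) → ℝ},
      IsClassicalNSSolutionOn (Iio 0) 1 0 u p → HasTypeIDecay C₀ u →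
        ∀ t ≤ -(1 / 4 : ℝ), ∀ x, ‖iteratedFDeriv ℝ 2 (u t) x‖ ≤ K₂ := by
  obtain ⟨Cw, Lw, N, hwin⟩ :=
    KNSS2009_regularity_boundedWeak_window_holds (3 * C₀) (17 / 8) (by norm_num)
  refine ⟨max (Cw 2 1) 0, le_max_right _ _, ?_⟩
  intro u p hcl hI t ht x
  set a : ℝ := t - 2 with ha
  set w : ℝ → EuclideanSpace ℝ (Fin 3) → EuclideanSpace ℝ (Fin 3) := fun τ => u (τ + a) with hw
  have hIoo : Ioo a (a + 17 / 8) ⊆ Iio 0 := fun τ hτ => by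
    simp only [mem_Iio]; linarith [hτ.2]
  have hneg : ∀ τ ∈ Ioo (0 : ℝ) (17 / 8), τ + a < -(1 / 8 : ℝ) := fun τ hτ => by
    linarith [hτ.2]
  have hcl' : IsClassicalNSSolutionOn (Ioo a (a + 17 / 8)) 1 0 u p :=
    hcl.mono hIoo (uniqueDiffOn_Ioo _ _)
  have hbdd : IsBoundedOn (Ioo a (a + 17 / 8)) u :=
    ⟨3 * C₀, fun τ hτ x => ChaeWolf.typeI_norm_le_three_mul hC₀ hI (by linarith [hτ.2]) x⟩
  have hweak : IsBoundedWeakNSSolutionOn (Ioo 0 (17 / 8)) isOpen_Ioo 1 w :=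
    (hcl'.isBoundedWeakNSSolutionOn hbdd).comp_add_right a (J := Ioo 0 (17 / 8)) isOpen_Ioo
      fun τ => by
        simp only [mem_Ioo]
        constructor <;> intro h <;> constructor <;> linarith [h.1, h.2]
  have hM : ∀ τ ∈ Ioo (0 : ℝ) (17 / 8), ∀ x, ‖w τ x‖ ≤ 3 * C₀ := fun τ hτ x =>
    ChaeWolf.typeI_norm_le_three_mul hC₀ hI (hneg τ hτ) x
  obtain ⟨U, b, -, -, -, hae, hUs, -, hUC, -, -⟩ := hwin hweak hM
  have hws : IsSmoothSpaceTimeOn (Ioo 0 (17 / 8)) w := by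
    have h1 := hcl.smooth_velocity.comp_add_right a
    refine h1.mono fun τ hτ => ?_
    simp only [mem_preimage, mem_Iio]
    linarith [hneg τ hτ]
  have key := window_transfer_hess hws hae hUs (hUC 1 one_pos 2)
  have h2 : (2 : ℝ) ∈ Ioo (1 : ℝ) (17 / 8) := ⟨by norm_num, by norm_num⟩
  have e2 : w 2 = u t := by simp only [hw, ha]; congr 1; ring
  have := key 2 h2 x
  rw [e2] at this
  exact this.trans (le_max_left _ _)

/-! ## §2 Gradient decay on a period slab, by Landau interpolation -/

/-- **Gradient decay on a period slab for Type-I classical solutions.**  A classical solution on `t < 0`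
(`ν = 1`) with `HasTypeIDecay C₀ u` has `∇u(t,x) → 0` as `|x| → ∞`, uniformly on `t ∈ [−c², −1]`: on balls of
radius `2s` around a far point, `|u| ≤ εs/4` (Type-I decay) and `‖D²u‖ ≤ K₂` (§1), so Landau's inequality gives
`‖∇u‖ ≤ ε/2 + sK₂ ≤ ε` for `s = ε/(2(K₂ + 1))`. [folklore; Landau 1913 via `norm_iteratedFDeriv_succ_le_of_bounds`] -/
theorem chaeWolf_periodGradDecay {C₀ c : ℝ} (hC₀ : 0 ≤ C₀)
    {u : ℝ → (EuclideanSpace ℝ (Fin 3)) → (EuclideanSpace ℝ (Fin 3))} {p : ℝ → (EuclideanSpace ℝ (Fin 3)) → ℝ}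
    (hsol : IsClassicalNSSolutionOn (Iio 0) 1 0 u p) (hI : HasTypeIDecay C₀ u) :
    ∀ ε : ℝ, 0 < ε → ∃ R : ℝ, ∀ t ∈ Icc (-(c ^ 2)) (-1), ∀ x : EuclideanSpace ℝ (Fin 3),
      R ≤ ‖x‖ → ‖fderiv ℝ (u t) x‖ ≤ ε := by
  obtain ⟨K₂, hK₂, hhess⟩ := exists_uniform_hessBound hC₀
  have hvel := periodVelocityDecay_of_typeI (c := c) hI
  intro ε hε
  obtain ⟨s, hs⟩ : ∃ s : ℝ, s = ε / (2 * (K₂ + 1)) := ⟨_, rfl⟩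
  have hs0 : 0 < s := by rw [hs]; positivity
  obtain ⟨R₀, hR₀⟩ := hvel (ε * s / 4) (by positivity)
  refine ⟨R₀ + 2 * s, fun t ht x hx => ?_⟩
  have ht4 : t ≤ -(1 / 4 : ℝ) := by linarith [ht.2]
  have ht0 : t ∈ Iio (0 : ℝ) := by simp only [mem_Iio]; linarith [ht.2]
  have hsm : ContDiff ℝ ∞ (u t) := hsol.contDiff_velocity ht0
  have h0 : ∀ y ∈ ball x (2 * s), ‖iteratedFDeriv ℝ 0 (u t) y‖ ≤ ε * s / 4 := by
    intro y hy
    rw [norm_iteratedFDeriv_zero]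
    refine hR₀ t ht y ?_
    rw [mem_ball, dist_eq_norm] at hy
    have := norm_sub_norm_le x y
    rw [← norm_neg (x - y), neg_sub] at this
    linarith
  have h2 : ∀ y ∈ ball x (2 * s), ‖iteratedFDeriv ℝ (0 + 2) (u t) y‖ ≤ K₂ :=
    fun y _ => hhess hsol hI t ht4 y
  have key := Literature.Analysis.Calculus.norm_iteratedFDeriv_succ_le_of_bounds hsm hK₂ (k := 0)
    h0 h2 hs0 (by linarith)
  rw [Nat.zero_add, ChaeWolf.norm_iteratedFDeriv_one_eq_norm_fderiv] at key
  have hsK : s * K₂ ≤ ε / 2 := by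
    rw [hs, div_mul_eq_mul_div, div_le_div_iff₀ (by positivity) (by norm_num)]
    nlinarith
  calc ‖fderiv ℝ (u t) x‖ ≤ 2 * (ε * s / 4) / s + s * K₂ := key
    _ = ε / 2 + s * K₂ := by field_simp; ring
    _ ≤ ε := by linarith

/-- The constant of a Type-I bound is nonnegative (evaluate at `t = −1`, `x = 0`). [folklore] -/
theorem HasTypeIDecay.nonneg' {C : ℝ} {u : ℝ → (EuclideanSpace ℝ (Fin 3)) → (EuclideanSpace ℝ (Fin 3))}
    (h : HasTypeIDecay C u) : 0 ≤ C := by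
  have := h (-1) (by norm_num) 0
  simp only [norm_zero, neg_neg, Real.sqrt_one, zero_add, div_one] at this
  exact (norm_nonneg _).trans this

/-! ## §3 The three numbers theorem, hypothesis-free -/

/-- ★★ **THE STRAIN RECORD LAW ON CHAE–WOLF'S CLASS, HYPOTHESIS-FREE.**  Every `c`-DSS (`c > 1`) classical
solution (`ν = 1`) on `t < 0` with slices continuous into `L^q`, `q ≥ 3`, and a direction of positive strain
somewhere attains its strain number: at some `(t,x,e)`, `t < 0`, `|e| = 1`, `q > 0`, maximising
`(0 − s)q(s,y,e')` over `(−∞,0) × ℝ³ × S²`, `strainLap ≤ 0` and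
`(0 − t)q + ((0 − t)q)² − (0 − t)²·strainLap ≤ (0 − t)²·H` and `1 ≤ ((H − q²)/q²)·((0 − t)q)`.
[cite: ChaeWolf2017RemovingDSS, Theorem 1.1, §3 (3.6); KochNadirashviliSereginSverak2009, §4] -/
theorem dss_strain_record_law_holds {q : ℝ} (hq : 3 ≤ q) {c : ℝ} (hc : 1 < c)
    {u : ℝ → (EuclideanSpace ℝ (Fin 3)) → (EuclideanSpace ℝ (Fin 3))} {p : ℝ → (EuclideanSpace ℝ (Fin 3)) → ℝ}
    (hsol : IsClassicalNSSolutionOn (Iio 0) 1 0 u p)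
    (hLq : ∀ t < 0, MemLp (u t) (ENNReal.ofReal q) volume)
    (hcont : ∀ t₀ < 0, Filter.Tendsto (fun t => eLpNorm (u t - u t₀) (ENNReal.ofReal q) volume)
      (nhdsWithin t₀ (Iio 0)) (nhds 0))
    (hdss : IsDiscretelySelfSimilar c u)
    (hpos : ∃ t₀ : ℝ, t₀ < 0 ∧ ∃ x₀ e₀ : EuclideanSpace ℝ (Fin 3), ‖e₀‖ = 1 ∧ 0 < strainQuad u t₀ x₀ e₀) :
    ∃ t : ℝ, t < 0 ∧ ∃ x e : EuclideanSpace ℝ (Fin 3), ‖e‖ = 1 ∧ 0 < strainQuad u t x e ∧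
      (∀ s : ℝ, s < 0 → ∀ y e' : EuclideanSpace ℝ (Fin 3), ‖e'‖ = 1 →
        (0 - s) * strainQuad u s y e' ≤ (0 - t) * strainQuad u t x e) ∧
      strainLap u t x e ≤ 0 ∧
      (0 - t) * strainQuad u t x e + ((0 - t) * strainQuad u t x e) ^ 2
          - (0 - t) ^ 2 * strainLap u t x e ≤ (0 - t) ^ 2 * strainFeed u p t x e ∧
      1 ≤ (strainFeed u p t x e - strainQuad u t x e ^ 2) / strainQuad u t x e ^ 2 *
          ((0 - t) * strainQuad u t x e) := by
  obtain ⟨C, hC⟩ := chaeWolf2017_dss_typeI_decay_holds q hq c hc u p hsol hLq hcont hdss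
  obtain ⟨t, ht, x, e, he, hqp, hsup, hlap, hlaw, hone⟩ := dss_strain_record_law zero_le_one hc hsol hdss
    (chaeWolf_periodGradDecay (c := c) (HasTypeIDecay.nonneg' hC) hsol hC) hpos
  refine ⟨t, ht, x, e, he, hqp, hsup, hlap, ?_, hone⟩
  simpa only [one_mul] using hlaw

/-- ★★ **THE VORTICITY RECORD LAW ON CHAE–WOLF'S CLASS, HYPOTHESIS-FREE.**  Same class with `ω ≢ 0`: at some
`(t,x)`, `t < 0`, `ω ≠ 0`, maximising `(0 − s)|ω(s,y)|` over `(−∞,0) × ℝ³`,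
`1 ≤ (0 − t)(ξ·∇u ξ − |∇ξ|²_F)` and `1 + (0 − t)|∇ξ|²_F ≤ (0 − t)q(t,x,ξ)`, `ξ = ω/|ω|`.
[cite: ChaeWolf2017RemovingDSS, Theorem 1.1, §3 (3.6); KochNadirashviliSereginSverak2009, §4] -/
theorem dss_vorticity_record_law_holds {q : ℝ} (hq : 3 ≤ q) {c : ℝ} (hc : 1 < c)
    {u : ℝ → (EuclideanSpace ℝ (Fin 3)) → (EuclideanSpace ℝ (Fin 3))} {p : ℝ → (EuclideanSpace ℝ (Fin 3)) → ℝ}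
    (hsol : IsClassicalNSSolutionOn (Iio 0) 1 0 u p)
    (hLq : ∀ t < 0, MemLp (u t) (ENNReal.ofReal q) volume)
    (hcont : ∀ t₀ < 0, Filter.Tendsto (fun t => eLpNorm (u t - u t₀) (ENNReal.ofReal q) volume)
      (nhdsWithin t₀ (Iio 0)) (nhds 0))
    (hdss : IsDiscretelySelfSimilar c u)
    (hcurl : ∃ t₀ : ℝ, t₀ < 0 ∧ ∃ x₀ : EuclideanSpace ℝ (Fin 3), curl (u t₀) x₀ ≠ 0) :
    ∃ t : ℝ, t < 0 ∧ ∃ x : EuclideanSpace ℝ (Fin 3), curl (u t) x ≠ 0 ∧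
      (∀ s : ℝ, s < 0 → ∀ y : EuclideanSpace ℝ (Fin 3),
        (0 - s) * ‖curl (u s) y‖ ≤ (0 - t) * ‖curl (u t) x‖) ∧
      1 ≤ (0 - t) * (⟪vorticityDirection (curl (u t)) x,
          fderiv ℝ (u t) x (vorticityDirection (curl (u t)) x)⟫ -
          frobeniusNormSq (fderiv ℝ (vorticityDirection (curl (u t))) x)) ∧
      ‖vorticityDirection (curl (u t)) x‖ = 1 ∧
      1 + (0 - t) * frobeniusNormSq (fderiv ℝ (vorticityDirection (curl (u t))) x) ≤
        (0 - t) * strainQuad u t x (vorticityDirection (curl (u t)) x) := by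
  obtain ⟨C, hC⟩ := chaeWolf2017_dss_typeI_decay_holds q hq c hc u p hsol hLq hcont hdss
  obtain ⟨t, ht, x, hne, hsup, hone, hξ, hfl⟩ := dss_vorticity_record_law zero_le_one hc hsol hdss
    (chaeWolf_periodGradDecay (c := c) (HasTypeIDecay.nonneg' hC) hsol hC) hcurl
  refine ⟨t, ht, x, hne, hsup, ?_, hξ, ?_⟩
  · simpa only [one_mul] using hone
  · simpa only [one_mul] using hfl

/-- ★★★ **THE THREE NUMBERS OF A DSS SINGULARITY — UNCONDITIONAL ON CHAE–WOLF'S CLASS.**  Let `(u,p)` be a classical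
solution of the unforced Navier–Stokes equations (`ν = 1`) on `t < 0`, `c`-discretely self-similar (`c > 1`),
with slices continuous into `L^q(ℝ³)`, `q ≥ 3`, and `ω ≢ 0` — i.e. ANY candidate for a DSS blow-up in the class of
Chae–Wolf's Theorem 1.1 / Bradshaw–Tsai's Open Problem 5.1.  Then:
(N) at some `(t,x,e)`, `t < 0`, `|e| = 1`, maximising `(0 − s)q(s,y,e')` over `(−∞,0) × ℝ³ × S²`:
`N* := (0 − t)q ≥ 1` and `N* + N*² − (0 − t)²·strainLap ≤ (0 − t)²·strainFeed`;
(W) at some `(t_ω,x_ω)`, `ω ≠ 0`, maximising `(0 − s)|ω|`: `1 + (0 − t_ω)|∇ξ|²_F ≤ (0 − t_ω)q(ξ) ≤ N*`;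
(V) at some `(t_v,x_v)`, `u ≠ 0`, maximising `(0 − s)|u|²`: `|u|(1 + 2(0 − t_v)|∇û|²_F) ≤ 2(0 − t_v)(−û·∇p)` and
`|u| ≤ 2(0 − t_v)|∇p|`.
NO hypothesis beyond the class: Chae–Wolf's Type-I bound and KNSS §4 regularity enter through their tree proofs.
[cite: ChaeWolf2017RemovingDSS, Theorem 1.1, §3 (3.6) (arXiv:1610.09464 p. 3, 8); KochNadirashviliSereginSverak2009, §4; BradshawTsai2017, §5 (OP 5.1)] -/
theorem chaeWolf_dss_three_numbers_holds {q : ℝ} (hq : 3 ≤ q) {c : ℝ} (hc : 1 < c)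
    {u : ℝ → (EuclideanSpace ℝ (Fin 3)) → (EuclideanSpace ℝ (Fin 3))} {p : ℝ → (EuclideanSpace ℝ (Fin 3)) → ℝ}
    (hsol : IsClassicalNSSolutionOn (Iio 0) 1 0 u p)
    (hLq : ∀ t < 0, MemLp (u t) (ENNReal.ofReal q) volume)
    (hcont : ∀ t₀ < 0, Filter.Tendsto (fun t => eLpNorm (u t - u t₀) (ENNReal.ofReal q) volume)
      (nhdsWithin t₀ (Iio 0)) (nhds 0))
    (hdss : IsDiscretelySelfSimilar c u)
    (hcurl : ∃ t₀ : ℝ, t₀ < 0 ∧ ∃ x₀ : EuclideanSpace ℝ (Fin 3), curl (u t₀) x₀ ≠ 0) :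
    ∃ t : ℝ, t < 0 ∧ ∃ x e : EuclideanSpace ℝ (Fin 3), ‖e‖ = 1 ∧
      (∀ s : ℝ, s < 0 → ∀ y e' : EuclideanSpace ℝ (Fin 3), ‖e'‖ = 1 →
        (0 - s) * strainQuad u s y e' ≤ (0 - t) * strainQuad u t x e) ∧
      1 ≤ (0 - t) * strainQuad u t x e ∧
      (0 - t) * strainQuad u t x e + ((0 - t) * strainQuad u t x e) ^ 2
          - (0 - t) ^ 2 * strainLap u t x e ≤ (0 - t) ^ 2 * strainFeed u p t x e ∧
      ∃ tω : ℝ, tω < 0 ∧ ∃ xω : EuclideanSpace ℝ (Fin 3), curl (u tω) xω ≠ 0 ∧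
        (∀ s : ℝ, s < 0 → ∀ y : EuclideanSpace ℝ (Fin 3),
          (0 - s) * ‖curl (u s) y‖ ≤ (0 - tω) * ‖curl (u tω) xω‖) ∧
        1 + (0 - tω) * frobeniusNormSq (fderiv ℝ (vorticityDirection (curl (u tω))) xω) ≤
          (0 - tω) * strainQuad u tω xω (vorticityDirection (curl (u tω)) xω) ∧
        (0 - tω) * strainQuad u tω xω (vorticityDirection (curl (u tω)) xω) ≤ (0 - t) * strainQuad u t x e ∧
        ∃ tv : ℝ, tv < 0 ∧ ∃ xv : EuclideanSpace ℝ (Fin 3), u tv xv ≠ 0 ∧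
          (∀ s : ℝ, s < 0 → ∀ y : EuclideanSpace ℝ (Fin 3),
            (0 - s) * ‖u s y‖ ^ 2 ≤ (0 - tv) * ‖u tv xv‖ ^ 2) ∧
          ‖u tv xv‖ * (1 + 2 * (0 - tv) * frobeniusNormSq (fderiv ℝ (vorticityDirection (u tv)) xv)) ≤
            2 * (0 - tv) * (-⟪vorticityDirection (u tv) xv, gradient (p tv) xv⟫) ∧
          ‖u tv xv‖ ≤ 2 * (0 - tv) * ‖gradient (p tv) xv‖ := by
  obtain ⟨C, hC⟩ := chaeWolf2017_dss_typeI_decay_holds q hq c hc u p hsol hLq hcont hdss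
  exact chaeWolf_dss_three_numbers_of_gradDecay hq hc hsol hLq hcont hdss
    (chaeWolf_periodGradDecay (c := c) (HasTypeIDecay.nonneg' hC) hsol hC) hcurl

end Summit.NavierStokesRegularity.NavierStokesRegularity.Theorems.StrainDoors

end
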